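import Summits.ResolutionOfSingularities.ResolutionOfSingularities.Theorems.WildQuotientsSummitReductionStubPairOrbitNormalFormBlowupModelCharts4
import HarnessLib

/-!
# `WildQuotients.SummitReduction` (stmt-ResolutionOfSingularities-16324), line `FramePerfect`, stub NB1
# (`stub_pair_orbitNormalFormBlowup_modelSingularOverCentre`): test primes on the chart `z_a ≠ 0`
# — the strict transform of `V(z_u, z_v, z_k, z_{k'})`

Route `ResolutionOfSingularities/WildQuotients`, crux `SummitReduction`; fifth helper file of
stub NB1 = de Jong 1996, Claim 4.27 [C1] on the coefficient-free model (test primes: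
`…OrbitNormalFormBlowupModelCharts4.lean`). PROVED here:

* **`testPrime_le_caseB`** — for `K = (z_k, z_{k'}, z_u, z_v)` (two further branches) and a
  prime `Q ∋ z_a, e₀, e₁, z_k, z_{k'}` of the chart ring `R[I/z_a]`, the test prime `𝔯_{θ_K}`
  lies below `Q` ("the component `u' = v' = t₃ = t₄ = 0` is the strict transform of the
  component `u = v = t₃ = t₄ = 0`"). Modulo `(T₀, T₁)` an element of `ker Θ` is a polynomial
  `q(T₃)` with `q̄(z̄_b/z̄_a) = 0` over the domain `D = R/K`; since `z̄_a` is prime to `z̄_b` in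
  `D` (`D/(z̄_a) = R/(K, z_a)` is a regular local domain in which `z_b ≠ 0`),
  `q̄ ∈ (z̄_a Y - z̄_b) D[Y]` (`Polynomial.mem_span_C_mul_X_sub_C_of_aeval_div_eq_zero`), and
  `z_a e₃ - z_b = 0` on the chart, the remainder having coefficients in `K`.

## Sources

* A. J. de Jong, *Smoothness, semi-stability and alterations*, Publ. Math. IHÉS 83 (1996), 4.27,
  p. 76. [DeJong1996]
* A. J. de Jong, *Families of curves and alterations*, Ann. Inst. Fourier 47 (1997), proof of
  Prop. 5.11, p. 619. [DeJong1997]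
-/

set_option linter.dupNamespace false -- the tree's summit namespace repeats `ResolutionOfSingularities`

noncomputable section

open IsLocalRing

namespace Summit.ResolutionOfSingularities.ResolutionOfSingularities.Theorems

open Literature.AlgebraicGeometry.Resolution

/-- **The test prime below `Q`, case B** (two further branches `z_k, z_{k'}`: the strict
transform of `V(z_u, z_v, z_k, z_{k'})`, "the component `u' = v' = t₃ = t₄ = 0` is the strict
transform of the component `u = v = t₃ = t₄ = 0`"): for the prime `K = (z_k, z_{k'}, z_u, z_v)` of
`R` and a prime `Q ∋ z_a` of `R[I/z_a]` containing `e₀, e₁, z_k, z_{k'}`, the test prime `𝔯_{θ_K}`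
lies below `Q`. Modulo `(T₀, T₁)` an element of `ker Θ` is a polynomial `q(T₃)` with
`q(z̄_b/z̄_a) = 0` over `D = R/K`; as `z̄_a` is prime to `z̄_b` in `D` (the quotient
`D/(z̄_a) = R/(K, z_a)` is a domain not killing `z_b`), `q̄ ∈ (z̄_a Y - z̄_b)`
(`Polynomial.mem_span_C_mul_X_sub_C_of_aeval_div_eq_zero`), and `z_a e₃ - z_b = 0` in the chart.
[cite: DeJong1996, 4.27, p. 76] -/
theorem testPrime_le_caseB {R : Type} [CommRing R] {N : ℕ} {z : Fin N → R} {ι : Fin 4 → Fin N} {k k' : Fin N}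
    (Q : Ideal (blowupAlgebra (Ideal.span (Set.range (z ∘ ι))) ((z ∘ ι) 2))) [Q.IsPrime]
    (h2 : algebraMap R (blowupAlgebra (Ideal.span (Set.range (z ∘ ι))) ((z ∘ ι) 2)) ((z ∘ ι) 2) ∈ Q)
    (hu : blowupAlgebra.frac (z ∘ ι) 2 0 ∈ Q) (hv : blowupAlgebra.frac (z ∘ ι) 2 1 ∈ Q)
    (hkQ : algebraMap R (blowupAlgebra (Ideal.span (Set.range (z ∘ ι))) ((z ∘ ι) 2)) (z k) ∈ Q)
    (hk'Q : algebraMap R (blowupAlgebra (Ideal.span (Set.range (z ∘ ι))) ((z ∘ ι) 2)) (z k') ∈ Q)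
    [(Ideal.span (Set.range (z ∘ Fin.cons k (Fin.cons k' (ι ∘ Fin.castAdd 2))))).IsPrime]
    (ha : (z ∘ ι) 2 ∉ Ideal.span (Set.range (z ∘ Fin.cons k (Fin.cons k' (ι ∘ Fin.castAdd 2)))))
    [(Ideal.span (Set.range (z ∘ Fin.cons (ι 2)
      (Fin.cons k (Fin.cons k' (ι ∘ Fin.castAdd 2)))))).IsPrime]
    (hb : (z ∘ ι) 3 ∉ Ideal.span (Set.range (z ∘ Fin.cons (ι 2)
      (Fin.cons k (Fin.cons k' (ι ∘ Fin.castAdd 2)))))) :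
    ((RingHom.ker (MvPolynomial.eval₂Hom ((Localization.awayLift ((algebraMap _
      (FractionRing (R ⧸ Ideal.span (Set.range (z ∘ Fin.cons k (Fin.cons k'
        (ι ∘ Fin.castAdd 2))))))).comp
        (Ideal.Quotient.mk _)) ((z ∘ ι) 2) (isUnit_test_comp_mk _ ha)).comp
          (algebraMap R (Localization.Away ((z ∘ ι) 2))))
      fun j : {j : Fin 4 // j ≠ 2} => (Localization.awayLift ((algebraMap _
      (FractionRing (R ⧸ Ideal.span (Set.range (z ∘ Fin.cons k (Fin.cons k'
        (ι ∘ Fin.castAdd 2))))))).comp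
        (Ideal.Quotient.mk _)) ((z ∘ ι) 2) (isUnit_test_comp_mk _ ha))
          (blowupAlgebra.frac (z ∘ ι) 2 j.1))).map (blowupAlgebra.eval (z ∘ ι) 2).toRingHom) ≤ Q := by
  classical
  -- notation
  set K : Ideal R := Ideal.span (Set.range (z ∘ Fin.cons k (Fin.cons k' (ι ∘ Fin.castAdd 2))))
    with hK
  set θ := Localization.awayLift ((algebraMap _ (FractionRing (R ⧸ K))).comp (Ideal.Quotient.mk _))
    ((z ∘ ι) 2) (isUnit_test_comp_mk _ ha) with hθ
  have hθr : ∀ r : R, θ (algebraMap R (Localization.Away ((z ∘ ι) 2)) r) =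
      algebraMap (R ⧸ K) (FractionRing (R ⧸ K)) (Ideal.Quotient.mk K r) := fun r => by
    rw [hθ, awayLift_algebraMap K ha r, RingHom.comp_apply]
  have hθr0 : ∀ r : R, θ (algebraMap R (Localization.Away ((z ∘ ι) 2)) r) = 0 ↔ r ∈ K := fun r => by
    rw [hθ, awayLift_algebraMap K ha r, test_comp_mk_eq_zero_iff]
  -- the variables `T₀, T₁`
  have hvars : ∀ j : {j : Fin 4 // j ≠ 2}, j ≠ ⟨3, by decide⟩ →
      blowupAlgebra.frac (z ∘ ι) 2 j.1 ∈ Q ∧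
        θ (blowupAlgebra.frac (z ∘ ι) 2 j.1 : Localization.Away ((z ∘ ι) 2)) = 0 := by
    intro j hj3
    rw [test_frac_eq_zero_iff, hθr0]
    rcases Fin.subtype_ne_two_cases j with rfl | rfl | rfl
    · exact ⟨hu, Ideal.subset_span ⟨2, rfl⟩⟩
    · exact ⟨hv, Ideal.subset_span ⟨3, rfl⟩⟩
    · exact absurd rfl hj3
  -- `K R[I/z_a] ⊆ Q`
  have hKQ : K.map (algebraMap R (blowupAlgebra (Ideal.span (Set.range (z ∘ ι))) ((z ∘ ι) 2))) ≤ Q := by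
    rw [hK, Ideal.map_span, Ideal.span_le]
    rintro _ ⟨_, ⟨i, rfl⟩, rfl⟩
    have hI : ∀ j : Fin 4, algebraMap R (blowupAlgebra (Ideal.span (Set.range (z ∘ ι))) ((z ∘ ι) 2))
        ((z ∘ ι) j) ∈ Q := fun j => by
      have := eval_C_mem_of_mem (z ∘ ι) 2 Q h2 _ (Ideal.subset_span ⟨j, rfl⟩)
      change blowupAlgebra.eval (z ∘ ι) 2 (MvPolynomial.C _) ∈ Q at this
      rwa [blowupAlgebra.eval_C] at this
    fin_cases i
    · exact hkQ
    · exact hk'Q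
    · exact hI 0
    · exact hI 1
  -- `α = z̄_a`, `β = z̄_b` in `D = R/K`: `α ∣ β x ⇒ α ∣ x`
  have hα0 : Ideal.Quotient.mk K ((z ∘ ι) 2) ≠ 0 := fun h0 => ha (Ideal.Quotient.eq_zero_iff_mem.mp h0)
  have hspan : (Ideal.span {Ideal.Quotient.mk K ((z ∘ ι) 2)} : Ideal (R ⧸ K)) =
      (Ideal.span (Set.range (z ∘ Fin.cons (ι 2)
        (Fin.cons k (Fin.cons k' (ι ∘ Fin.castAdd 2)))))).map (Ideal.Quotient.mk K) := by
    apply le_antisymm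
    · rw [Ideal.span_le, Set.singleton_subset_iff]
      exact Ideal.mem_map_of_mem _ (Ideal.subset_span ⟨0, rfl⟩)
    · rw [Ideal.map_span, Ideal.span_le]
      rintro _ ⟨_, ⟨i, rfl⟩, rfl⟩
      refine Fin.cases ?_ (fun i => ?_) i
      · exact Ideal.subset_span rfl
      · have hmem : (z ∘ Fin.cons (ι 2) (Fin.cons k (Fin.cons k' (ι ∘ Fin.castAdd 2)))) i.succ ∈ K :=
          Ideal.subset_span ⟨i, rfl⟩
        rw [SetLike.mem_coe, Ideal.Quotient.eq_zero_iff_mem.mpr hmem]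
        exact Ideal.zero_mem _
  have hker : RingHom.ker (Ideal.Quotient.mk K) ≤ Ideal.span (Set.range (z ∘ Fin.cons (ι 2)
      (Fin.cons k (Fin.cons k' (ι ∘ Fin.castAdd 2))))) := by
    rw [Ideal.mk_ker, hK]
    refine Ideal.span_mono ?_
    rintro _ ⟨i, rfl⟩
    exact ⟨i.succ, rfl⟩
  haveI hprimeα : (Ideal.span {Ideal.Quotient.mk K ((z ∘ ι) 2)} : Ideal (R ⧸ K)).IsPrime := by
    rw [hspan]
    exact Ideal.map_isPrime_of_surjective Ideal.Quotient.mk_surjective hker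
  have hβ : Ideal.Quotient.mk K ((z ∘ ι) 3) ∉ (Ideal.span {Ideal.Quotient.mk K ((z ∘ ι) 2)} : Ideal (R ⧸ K)) := by
    rw [hspan]
    intro hmem
    apply hb
    have : (z ∘ ι) 3 ∈ ((Ideal.span (Set.range (z ∘ Fin.cons (ι 2)
        (Fin.cons k (Fin.cons k' (ι ∘ Fin.castAdd 2)))))).map (Ideal.Quotient.mk K)).comap
        (Ideal.Quotient.mk K) := hmem
    rwa [Ideal.comap_map_of_surjective _ Ideal.Quotient.mk_surjective, ← RingHom.ker_eq_comap_bot,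
      sup_eq_left.mpr hker] at this
  have hαβ : ∀ x : R ⧸ K, Ideal.Quotient.mk K ((z ∘ ι) 2) ∣ Ideal.Quotient.mk K ((z ∘ ι) 3) * x →
      Ideal.Quotient.mk K ((z ∘ ι) 2) ∣ x := by
    intro x hx
    have hmem : Ideal.Quotient.mk K ((z ∘ ι) 3) * x ∈
        (Ideal.span {Ideal.Quotient.mk K ((z ∘ ι) 2)} : Ideal (R ⧸ K)) := Ideal.mem_span_singleton.mpr hx
    rcases hprimeα.mem_or_mem hmem with h | h
    · exact absurd h hβ
    · exact Ideal.mem_span_singleton.mp h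
  -- the value `θ(e₃) = β/α`
  have hfrac3 : θ (blowupAlgebra.frac (z ∘ ι) 2 3 : Localization.Away ((z ∘ ι) 2)) =
      algebraMap (R ⧸ K) (FractionRing (R ⧸ K)) (Ideal.Quotient.mk K ((z ∘ ι) 3)) /
        algebraMap (R ⧸ K) (FractionRing (R ⧸ K)) (Ideal.Quotient.mk K ((z ∘ ι) 2)) := by
    rw [eq_div_iff (by rw [← hθr]; exact test_centre_ne_zero θ), ← hθr, ← hθr]
    exact test_frac_mul θ 3
  -- the main inclusion
  intro x hx
  rw [Ideal.mem_map_iff_of_surjective (blowupAlgebra.eval (z ∘ ι) 2).toRingHom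
    (fun y => blowupAlgebra.eval_surjective (z ∘ ι) 2 y)] at hx
  obtain ⟨m, hm, rfl⟩ := hx
  rw [RingHom.mem_ker] at hm
  have hsub := MvPolynomial.sub_aeval_aeval_mem_span (⟨3, by decide⟩ : {j : Fin 4 // j ≠ 2}) m
  set q : Polynomial R := MvPolynomial.aeval
    (fun j : {j : Fin 4 // j ≠ 2} => if j = ⟨3, by decide⟩ then (Polynomial.X : Polynomial R) else 0) m with hq
  -- (i) `eval (m - ι q) ∈ Q`
  have h1 : blowupAlgebra.eval (z ∘ ι) 2 (m - Polynomial.aeval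
      (MvPolynomial.X ⟨3, by decide⟩ : MvPolynomial {j : Fin 4 // j ≠ 2} R) q) ∈ Q :=
    map_eval_span_X_image_le Q (fun j hj => (hvars j hj).1) (Ideal.mem_map_of_mem _ hsub)
  -- (ii) `Θ (ι q) = 0`
  have hvan : Ideal.span (MvPolynomial.X '' {j : {j : Fin 4 // j ≠ 2} | j ≠ ⟨3, by decide⟩}) ≤
      RingHom.ker (MvPolynomial.eval₂Hom (θ.comp (algebraMap R (Localization.Away ((z ∘ ι) 2))))
        fun j : {j : Fin 4 // j ≠ 2} => θ (blowupAlgebra.frac (z ∘ ι) 2 j.1)) := by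
    rw [Ideal.span_le]
    rintro _ ⟨j, hj, rfl⟩
    rw [SetLike.mem_coe, RingHom.mem_ker, MvPolynomial.eval₂Hom_X']
    exact (hvars j hj).2
  have h2' := hvan hsub
  rw [RingHom.mem_ker, map_sub, hm, zero_sub, neg_eq_zero] at h2'
  -- (iii) `Θ ∘ ι = eval₂ ψ (β/α)`
  have hΘι : (MvPolynomial.eval₂Hom (θ.comp (algebraMap R (Localization.Away ((z ∘ ι) 2))))
      (fun j : {j : Fin 4 // j ≠ 2} => θ (blowupAlgebra.frac (z ∘ ι) 2 j.1))).comp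
      (Polynomial.aeval (MvPolynomial.X ⟨3, by decide⟩ : MvPolynomial {j : Fin 4 // j ≠ 2} R)).toRingHom =
      Polynomial.eval₂RingHom ((algebraMap (R ⧸ K) (FractionRing (R ⧸ K))).comp (Ideal.Quotient.mk K))
        (algebraMap (R ⧸ K) (FractionRing (R ⧸ K)) (Ideal.Quotient.mk K ((z ∘ ι) 3)) /
          algebraMap (R ⧸ K) (FractionRing (R ⧸ K)) (Ideal.Quotient.mk K ((z ∘ ι) 2))) := by
    refine Polynomial.ringHom_ext (fun r => ?_) ?_
    · rw [RingHom.comp_apply, Polynomial.coe_eval₂RingHom, Polynomial.eval₂_C]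
      change (MvPolynomial.eval₂Hom _ _) (Polynomial.aeval _ (Polynomial.C r)) = _
      rw [Polynomial.aeval_C, MvPolynomial.algebraMap_eq, MvPolynomial.eval₂Hom_C, RingHom.comp_apply, hθr,
        RingHom.comp_apply]
    · rw [RingHom.comp_apply, Polynomial.coe_eval₂RingHom, Polynomial.eval₂_X]
      change (MvPolynomial.eval₂Hom _ _) (Polynomial.aeval _ Polynomial.X) = _
      rw [Polynomial.aeval_X, MvPolynomial.eval₂Hom_X']
      exact hfrac3
  have haeval : Polynomial.aeval (algebraMap (R ⧸ K) (FractionRing (R ⧸ K)) (Ideal.Quotient.mk K ((z ∘ ι) 3)) /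
      algebraMap (R ⧸ K) (FractionRing (R ⧸ K)) (Ideal.Quotient.mk K ((z ∘ ι) 2)))
        (q.map (Ideal.Quotient.mk K)) = 0 := by
    rw [Polynomial.aeval_def, Polynomial.eval₂_map, ← Polynomial.coe_eval₂RingHom, ← hΘι]
    exact h2'
  -- (iv) `q̄ ∈ (α Y - β)`, lift the cofactor
  obtain ⟨g', hg'⟩ := Ideal.mem_span_singleton'.mp
    (Polynomial.mem_span_C_mul_X_sub_C_of_aeval_div_eq_zero hα0 hαβ haeval)
  obtain ⟨g, rfl⟩ := Polynomial.map_surjective (Ideal.Quotient.mk K) Ideal.Quotient.mk_surjective g'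
  have hdiff : q - g * (Polynomial.C ((z ∘ ι) 2) * Polynomial.X - Polynomial.C ((z ∘ ι) 3)) ∈
      K.map (Polynomial.C : R →+* Polynomial R) := by
    rw [← Ideal.mk_ker (I := K), ← Polynomial.ker_mapRingHom, RingHom.mem_ker, Polynomial.coe_mapRingHom,
      Polynomial.map_sub, Polynomial.map_mul, Polynomial.map_sub, Polynomial.map_mul, Polynomial.map_C,
      Polynomial.map_C, Polynomial.map_X, hg', sub_self]
  -- (v) evaluate at `e₃`
  have hev0 : Polynomial.aeval (blowupAlgebra.frac (z ∘ ι) 2 3)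
      (Polynomial.C ((z ∘ ι) 2) * Polynomial.X - Polynomial.C ((z ∘ ι) 3)) = 0 := by
    rw [map_sub, map_mul, Polynomial.aeval_C, Polynomial.aeval_X, Polynomial.aeval_C,
      blowupAlgebra.algebraMap_mul_gen, sub_self]
  have hevC : (Polynomial.aeval (blowupAlgebra.frac (z ∘ ι) 2 3) :
      Polynomial R →ₐ[R] blowupAlgebra (Ideal.span (Set.range (z ∘ ι))) ((z ∘ ι) 2)).toRingHom.comp
        Polynomial.C = algebraMap R _ :=
    RingHom.ext fun r => Polynomial.aeval_C _ r
  have hevq : Polynomial.aeval (blowupAlgebra.frac (z ∘ ι) 2 3) q ∈ Q := by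
    have hsplit : q = (q - g * (Polynomial.C ((z ∘ ι) 2) * Polynomial.X - Polynomial.C ((z ∘ ι) 3))) +
        g * (Polynomial.C ((z ∘ ι) 2) * Polynomial.X - Polynomial.C ((z ∘ ι) 3)) := by ring
    rw [hsplit, map_add, map_mul, hev0, mul_zero, add_zero]
    refine hKQ ?_
    rw [← hevC, ← Ideal.map_map]
    exact Ideal.mem_map_of_mem _ hdiff
  -- (vi) `eval (ι q) = aeval e₃ q`
  have hιev : (blowupAlgebra.eval (z ∘ ι) 2).comp
      (Polynomial.aeval (MvPolynomial.X ⟨3, by decide⟩ : MvPolynomial {j : Fin 4 // j ≠ 2} R)) =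
      Polynomial.aeval (blowupAlgebra.frac (z ∘ ι) 2 3) := by
    refine Polynomial.algHom_ext ?_
    rw [AlgHom.comp_apply, Polynomial.aeval_X, Polynomial.aeval_X, blowupAlgebra.eval_X]
  have h3 : blowupAlgebra.eval (z ∘ ι) 2 (Polynomial.aeval
      (MvPolynomial.X ⟨3, by decide⟩ : MvPolynomial {j : Fin 4 // j ≠ 2} R) q) ∈ Q := by
    rw [← AlgHom.comp_apply, hιev]
    exact hevq
  -- (vii) assemble
  change blowupAlgebra.eval (z ∘ ι) 2 m ∈ Q
  have hsplit : blowupAlgebra.eval (z ∘ ι) 2 m = blowupAlgebra.eval (z ∘ ι) 2 (m - Polynomial.aeval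
      (MvPolynomial.X ⟨3, by decide⟩ : MvPolynomial {j : Fin 4 // j ≠ 2} R) q) +
      blowupAlgebra.eval (z ∘ ι) 2 (Polynomial.aeval
        (MvPolynomial.X ⟨3, by decide⟩ : MvPolynomial {j : Fin 4 // j ≠ 2} R) q) := by
    rw [map_sub, sub_add_cancel]
  rw [hsplit]
  exact Ideal.add_mem _ h1 h3

end Summit.ResolutionOfSingularities.ResolutionOfSingularities.Theorems

end
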